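import Mathlib
import Summits.AtomisticToContinuum.HydrodynamicLimit.Theorems.InformationPercolationEngineKickFairRelEquilibriumMesoLongWindowDefs
import Summits.AtomisticToContinuum.HydrodynamicLimit.Theorems.KickFairRelEquilibriumMeso.Negative.WindowAlgebra
import HarnessLib

/-!
# Vocabulary of the line `kinetic-window-cut`, rev 5 — PER-PROFILE forms of the rev-5 statements and the EQUILIBRIUM body of the crux
(crux `KickFairRelEquilibriumMeso`, stmt-AtomisticToContinuum-15177; lead c8)

Definitions-only support file (`--supports stmt-AtomisticToContinuum-15177`). Every statement of the line (`MesoBody`, `SingleKickBias`, `ShortFlightLG`,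
`SameWindowPairCovLong`, `ClosePairCountLong`, `TruncatedFluctuationLong`) has the shape `∀ (a₀ θ₀ u₀), continuous → positive → BODY(a₀, θ₀, u₀)`, and
every landed reduction of rev 5 (`mesoBody_of_long` p163594, `truncatedFluctuationLong_of_window` p163373) is proved profile by profile. This file names
the bodies (`MesoBodyAt`, `SingleKickBiasAt`, `ShortFlightLGAt`, `SameWindowPairCovLongAt`, `ClosePairCountLongAt`, `TruncatedFluctuationLongAt`; each
global statement is DEFINITIONALLY `∀ profiles, hypotheses → …At`, certified below by `Iff.rfl`), so that the reductions can be re-landed per profile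
and then specialised to CONSTANT profiles, where B1 is trivial (`betaLG_const_ae_eq_zero` p156240), U is landed (`shortFlightLG_rung0` p126384), CPL is
landed for all profiles (p164751) and SWL reduces to pure decorrelation (`sameWindowPairCovLongConst_of_decorrelation` p163327): the EQUILIBRIUM body
of the crux, `EquilibriumMesoBody rs := ∀ (a θ : ℝ) (u : V3), 0 < a → 0 < θ → MesoBodyAt rs a θ u` (the crux's body with the profiles frozen to
constants — the support statement `EquilibriumKickFairMeso` recommended by strategist p1 R2 / planner kinetic-window-triangle, now over the line's
vocabulary), then follows from `FarPairDecorrelationLongConst rs` alone. Nothing is asserted: every `def … : Prop` is a predicate; the `Iff.rfl` /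
one-line theorems are sanity certificates (registered sub-goal `equilibriumMesoBody_of_mesoBody`).
-/

noncomputable section

open MeasureTheory Set Filter Topology
open scoped ENNReal Classical

namespace Summit.AtomisticToContinuum.HydrodynamicLimit.Theorems.KickFairRelEquilibriumMesoLine

open Literature.Analysis.FluidPDE Literature.MathematicalPhysics.KineticTheory
open Summit.AtomisticToContinuum.HydrodynamicLimit.Theorems.KickFairRelEquilibriumMesoNegative (KickBoundRel MesoBody)

/-! ## Per-profile bodies -/

/-- **The body of the crux at GIVEN profiles** (everything in `MesoBody rs` after the profile hypotheses): `∃ σ₀ ∀ σ < σ₀ ∀ Φ τ g δ ∃ N₀ ∀ N ≥ N₀ ∀ h`,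
`KickBoundRel σ a₀ θ₀ u₀ N (Φ N) τ (rs N) g h δ`. -/
def MesoBodyAt (rs : ℕ → ℝ) (a₀ θ₀ : T3 → ℝ) (u₀ : T3 → V3) : Prop :=
    ∃ σ₀ : ℝ, 0 < σ₀ ∧ ∀ σ : ℝ, 0 < σ → σ < σ₀ →
    ∀ Φ : (N : ℕ) → Flow σ N, ∀ τ : ℝ, 0 < τ →
    ∀ g : V3 × V3 × V3 → ℝ, Continuous g → (∃ C : ℝ, ∀ p, |g p| ≤ C) →
    ∀ δ : ℝ, 0 < δ → ∃ N₀ : ℕ, ∀ N : ℕ, N₀ ≤ N →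
    ∀ h : Fin (N + 1) → ℕ → Past N → ℝ, (∀ i n, Measurable (h i n)) →
    (∀ i n p, |h i n p| ≤ 1) → KickBoundRel σ a₀ θ₀ u₀ N (Φ N) τ (rs N) g h δ

/-- **B1 at given profiles** (the body of `SingleKickBias rs`). -/
def SingleKickBiasAt (rs : ℕ → ℝ) (a₀ θ₀ : T3 → ℝ) (u₀ : T3 → V3) : Prop :=
    ∃ σ₀ : ℝ, 0 < σ₀ ∧ ∀ σ : ℝ, 0 < σ → σ < σ₀ →
    ∀ Φ : (N : ℕ) → Flow σ N, ∀ τ : ℝ, 0 < τ →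
    ∀ g : V3 × V3 × V3 → ℝ, Continuous g → (∃ C : ℝ, ∀ p, |g p| ≤ C) →
    ∀ δ : ℝ, 0 < δ → ∃ N₀ : ℕ, ∀ N : ℕ, N₀ ≤ N →
    ∫⁻ z, ENNReal.ofReal (hsDiameter σ N / ((N : ℝ) + 1) *
        ∑ i : Fin (N + 1), ∑ n ∈ Finset.range (cnt (Φ N) τ z i),
          |betaLG σ a₀ θ₀ u₀ (Φ N) (rs N) g i n z|) ∂(localGibbsLaw σ a₀ u₀ θ₀ N (Φ N)) ≤ ENNReal.ofReal δ

/-- **U at given profiles** (the body of `ShortFlightLG`). -/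
def ShortFlightLGAt (a₀ θ₀ : T3 → ℝ) (u₀ : T3 → V3) : Prop :=
    ∃ σ₀ : ℝ, 0 < σ₀ ∧ ∀ σ : ℝ, 0 < σ → σ < σ₀ → ∀ Φ : (N : ℕ) → Flow σ N, ∀ τ : ℝ, 0 < τ →
    ∀ δ : ℝ, 0 < δ → ∃ A : ℝ, 0 < A ∧ ∃ N₀ : ℕ, ∀ N : ℕ, N₀ ≤ N →
    ∫⁻ z, ENNReal.ofReal (hsDiameter σ N / ((N : ℝ) + 1) *
        ∑ i : Fin (N + 1), ∑ n ∈ Finset.range (cnt (Φ N) τ z i),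
          (if (past (Φ N) (rs N) z i n).2.2.2 - (past (Φ N) (rs N) z i n).2.1 < tN N / A then (1 : ℝ) else 0))
        ∂(localGibbsLaw σ a₀ u₀ θ₀ N (Φ N)) ≤ ENNReal.ofReal δ

/-- **SWL at given profiles** (the body of `SameWindowPairCovLong rs`). -/
def SameWindowPairCovLongAt (rs : ℕ → ℝ) (a₀ θ₀ : T3 → ℝ) (u₀ : T3 → V3) : Prop :=
    ∃ σ₀ : ℝ, 0 < σ₀ ∧ ∀ σ : ℝ, 0 < σ → σ < σ₀ →
    ∀ Φ : (N : ℕ) → Flow σ N, ∀ τ : ℝ, 0 < τ →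
    ∀ g : V3 × V3 × V3 → ℝ, Continuous g → (∃ C : ℝ, ∀ p, |g p| ≤ C) →
    ∀ A : ℝ, 0 < A → ∀ δ : ℝ, 0 < δ → ∃ N₀ : ℕ, ∀ N : ℕ, N₀ ≤ N →
    ∫⁻ z, ENNReal.ofReal (((N : ℝ) + 1) ^ (1 / 3 : ℝ) * (hsDiameter σ N / ((N : ℝ) + 1)) ^ 2 *
        ∑ i : Fin (N + 1), ∑ n ∈ Finset.range (cnt (Φ N) τ z i),
          ∑ i' : Fin (N + 1), ∑ n' ∈ Finset.range (cnt (Φ N) τ z i'),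
            (if IsLong A (tN N) (past (Φ N) (rs N) z i n) ∧ IsLong A (tN N) (past (Φ N) (rs N) z i' n') ∧
                PairFarL (rs N) A (tN N) (past (Φ N) (rs N) z i n) (past (Φ N) (rs N) z i' n') i i'
              then (1 : ℝ) else 0) *
              |pairCondCovLG σ a₀ θ₀ u₀ (Φ N) (rs N) g i n i' n' z|)
        ∂(localGibbsLaw σ a₀ u₀ θ₀ N (Φ N)) ≤ ENNReal.ofReal δ

/-- **CPL at given profiles** (the body of `ClosePairCountLong rs`). -/
def ClosePairCountLongAt (rs : ℕ → ℝ) (a₀ θ₀ : T3 → ℝ) (u₀ : T3 → V3) : Prop :=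
    ∃ σ₀ : ℝ, 0 < σ₀ ∧ ∀ σ : ℝ, 0 < σ → σ < σ₀ →
    ∀ Φ : (N : ℕ) → Flow σ N, ∀ τ : ℝ, 0 < τ →
    ∀ A : ℝ, 0 < A → ∀ δ : ℝ, 0 < δ → ∃ N₀ : ℕ, ∀ N : ℕ, N₀ ≤ N →
    ∫⁻ z, ENNReal.ofReal (((N : ℝ) + 1) ^ (1 / 3 : ℝ) * (hsDiameter σ N / ((N : ℝ) + 1)) ^ 2 *
        ∑ i : Fin (N + 1), ∑ n ∈ Finset.range (cnt (Φ N) τ z i),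
          ∑ i' : Fin (N + 1), ∑ n' ∈ Finset.range (cnt (Φ N) τ z i'),
            (if IsLong A (tN N) (past (Φ N) (rs N) z i n) ∧ IsLong A (tN N) (past (Φ N) (rs N) z i' n') ∧
                PairCloseL (rs N) A (tN N) (past (Φ N) (rs N) z i n) (past (Φ N) (rs N) z i' n') i i'
              then (1 : ℝ) else 0))
        ∂(localGibbsLaw σ a₀ u₀ θ₀ N (Φ N)) ≤ ENNReal.ofReal δ

/-- **TFL at given profiles** (the body of `TruncatedFluctuationLong rs`). -/
def TruncatedFluctuationLongAt (rs : ℕ → ℝ) (a₀ θ₀ : T3 → ℝ) (u₀ : T3 → V3) : Prop :=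
    ∃ σ₀ : ℝ, 0 < σ₀ ∧ ∀ σ : ℝ, 0 < σ → σ < σ₀ →
    ∀ Φ : (N : ℕ) → Flow σ N, ∀ τ : ℝ, 0 < τ →
    ∀ g : V3 × V3 × V3 → ℝ, Continuous g → (∃ C : ℝ, ∀ p, |g p| ≤ C) →
    ∀ A : ℝ, 0 < A → ∀ δ : ℝ, 0 < δ → ∃ N₀ : ℕ, ∀ N : ℕ, N₀ ≤ N → ∀ A' : ℝ, 0 < A' →
    ∀ h : Fin (N + 1) → ℕ → Past N → ℝ, (∀ i n, Measurable (h i n)) → (∀ i n p, |h i n p| ≤ 1) →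
    (∀ i n p, ¬ IsLong A (tN N) p → h i n p = 0) →
    ∫⁻ z, ENNReal.ofReal |hsDiameter σ N / ((N : ℝ) + 1) *
        ∑ i : Fin (N + 1), ∑ n ∈ Finset.range (cnt (Φ N) τ z i),
          (if (n : ℝ) < A' * ((N : ℝ) + 1) ^ (1 / 3 : ℝ) then (1 : ℝ) else 0) *
            (h i n (past (Φ N) (rs N) z i n) *
              (kickDev (Φ N) (rs N) g i n z - betaLG σ a₀ θ₀ u₀ (Φ N) (rs N) g i n z))|
      ∂(localGibbsLaw σ a₀ u₀ θ₀ N (Φ N)) ≤ ENNReal.ofReal δ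

/-! ## The equilibrium body of the crux -/

/-- **THE EQUILIBRIUM BODY OF THE CRUX** (`EquilibriumKickFairMeso` of strategist p1 R2 / planner kinetic-window-triangle, over the line vocabulary):
the body of `KickFairRelEquilibriumMeso` along `rs` with the data's profiles frozen to CONSTANTS `(a, θ, u)`, `a, θ > 0` — i.e. under the INVARIANT
canonical Gibbs law the past-weighted, equilibrium-centred kick sum is small in mean, uniformly over admissible weights. A consequence of the crux
body (`equilibriumMesoBody_of_mesoBody`); along `rs N = (N+1)^{-1/4}` it follows from `FarPairDecorrelationLongConst rs` alone (rev 5 of the line). -/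
def EquilibriumMesoBody (rs : ℕ → ℝ) : Prop :=
  ∀ (a θ : ℝ) (u : V3), 0 < a → 0 < θ → MesoBodyAt rs (fun _ => a) (fun _ => θ) (fun _ => u)

/-! ## Certificates: each global statement is `∀ profiles, hypotheses → …At` by definition -/

/-- `MesoBody` unfolded per profile. [folklore] -/
theorem mesoBody_iff_forall_at (rs : ℕ → ℝ) : MesoBody rs ↔ ∀ (a₀ θ₀ : T3 → ℝ) (u₀ : T3 → V3), Continuous a₀ → Continuous θ₀ → Continuous u₀ →
    (∀ x, 0 < a₀ x) → (∀ x, 0 < θ₀ x) → MesoBodyAt rs a₀ θ₀ u₀ := Iff.rfl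

/-- `SingleKickBias` unfolded per profile. [folklore] -/
theorem singleKickBias_iff_forall_at (rs : ℕ → ℝ) : SingleKickBias rs ↔ ∀ (a₀ θ₀ : T3 → ℝ) (u₀ : T3 → V3), Continuous a₀ → Continuous θ₀ →
    Continuous u₀ → (∀ x, 0 < a₀ x) → (∀ x, 0 < θ₀ x) → SingleKickBiasAt rs a₀ θ₀ u₀ := Iff.rfl

/-- `ShortFlightLG` unfolded per profile. [folklore] -/
theorem shortFlightLG_iff_forall_at : ShortFlightLG ↔ ∀ (a₀ θ₀ : T3 → ℝ) (u₀ : T3 → V3), Continuous a₀ → Continuous θ₀ →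
    Continuous u₀ → (∀ x, 0 < a₀ x) → (∀ x, 0 < θ₀ x) → ShortFlightLGAt a₀ θ₀ u₀ := Iff.rfl

/-- `SameWindowPairCovLong` unfolded per profile. [folklore] -/
theorem sameWindowPairCovLong_iff_forall_at (rs : ℕ → ℝ) : SameWindowPairCovLong rs ↔ ∀ (a₀ θ₀ : T3 → ℝ) (u₀ : T3 → V3), Continuous a₀ →
    Continuous θ₀ → Continuous u₀ → (∀ x, 0 < a₀ x) → (∀ x, 0 < θ₀ x) → SameWindowPairCovLongAt rs a₀ θ₀ u₀ := Iff.rfl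

/-- `ClosePairCountLong` unfolded per profile. [folklore] -/
theorem closePairCountLong_iff_forall_at (rs : ℕ → ℝ) : ClosePairCountLong rs ↔ ∀ (a₀ θ₀ : T3 → ℝ) (u₀ : T3 → V3), Continuous a₀ →
    Continuous θ₀ → Continuous u₀ → (∀ x, 0 < a₀ x) → (∀ x, 0 < θ₀ x) → ClosePairCountLongAt rs a₀ θ₀ u₀ := Iff.rfl

/-- `TruncatedFluctuationLong` unfolded per profile. [folklore] -/
theorem truncatedFluctuationLong_iff_forall_at (rs : ℕ → ℝ) : TruncatedFluctuationLong rs ↔ ∀ (a₀ θ₀ : T3 → ℝ) (u₀ : T3 → V3), Continuous a₀ →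
    Continuous θ₀ → Continuous u₀ → (∀ x, 0 < a₀ x) → (∀ x, 0 < θ₀ x) → TruncatedFluctuationLongAt rs a₀ θ₀ u₀ := Iff.rfl

/-- `SameWindowPairCovLongConst` is SWL at constant profiles. [folklore] -/
theorem sameWindowPairCovLongConst_iff (rs : ℕ → ℝ) : SameWindowPairCovLongConst rs ↔
    ∀ (a θ : ℝ) (u : V3), 0 < a → 0 < θ → SameWindowPairCovLongAt rs (fun _ => a) (fun _ => θ) (fun _ => u) := Iff.rfl

/-- **The equilibrium body is a consequence of the crux body** (registered sub-goal `equilibriumMesoBody_of_mesoBody`: constant positive profiles are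
continuous positive profiles). [folklore] -/
theorem equilibriumMesoBody_of_mesoBody : ∀ rs : ℕ → ℝ, MesoBody rs → EquilibriumMesoBody rs :=
  fun _ hM a θ u ha hθ => hM (fun _ => a) (fun _ => θ) (fun _ => u) continuous_const continuous_const continuous_const (fun _ => ha) (fun _ => hθ)

end Summit.AtomisticToContinuum.HydrodynamicLimit.Theorems.KickFairRelEquilibriumMesoLine

end
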